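import Mathlib
import Literature.Computability.AlgebraicComplexity.BirkhoffShadow
import Literature.Computability.AlgebraicComplexity.BirkhoffShadowProofs
import Literature.Computability.AlgebraicComplexity.BirkhoffShadowLowerBound
import Summits.ValiantsHypothesis.ValiantsHypothesis.Theses.DivisionGap
import Summits.ValiantsHypothesis.ValiantsHypothesis.Theorems.DivisionGapShadowBirkhoffStubFacePad
import Summits.ValiantsHypothesis.ValiantsHypothesis.Theorems.DivisionGapShadowBirkhoffStubFaceVertices
import Summits.ValiantsHypothesis.ValiantsHypothesis.Theorems.DivisionGapShadowBirkhoffStubFaceShadow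
import Summits.ValiantsHypothesis.ValiantsHypothesis.Theorems.DivisionGapShadowBirkhoffCounterDefs
import Summits.ValiantsHypothesis.ValiantsHypothesis.Theorems.DivisionGapShadowBirkhoffStubCounter
import Summits.ValiantsHypothesis.ValiantsHypothesis.Theorems.DivisionGapShadowBirkhoffStubTransfer
import Summits.ValiantsHypothesis.ValiantsHypothesis.Theorems.DivisionGapShadowBirkhoffStubGrowth
import Summits.ValiantsHypothesis.ValiantsHypothesis.Theorems.DivisionGapShadowBirkhoffStubBridge

/-!
# `DivisionGap.ShadowBirkhoff` (stmt-ValiantsHypothesis-5069) via the line `Sketch-ideator4`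
# (ternary two-polarity cut counter ⇒ flow-extended formulation) — skeleton v3

Registered crux skeleton of the line (lead prover-line-stmt-ValiantsHypothesis-5069-a3-0), reshaped from the
ideator's `Cruxes/ShadowBirkhoff/Sketch_ideator4.lean` + card `Ideas/ternary-cut-counter-fork.md` into five
registered stubs and a closed composition.  The objects (`valueSet`, `lowerVertices`, `sdot`, `qdis`, `X2`, `Y4`,
`counterVal`, `patternVal`) are those of the landed `Theorems/DivisionGapShadowBirkhoffCounterDefs.lean` (p134323), imported
here, so every stub signature below is literally the one the landed stub files carry.

State (v3): FOUR of the five stubs are LANDED theorems with literally the registered signatures — `stub_counter` (p134897,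
`Theorems/DivisionGapShadowBirkhoffStubCounter.lean`), `stub_transfer` (p134773, `…StubTransfer.lean`), `stub_growth` (p134716,
`…StubGrowth.lean`), `stub_bridge` (p134729, `…StubBridge.lean`), imported above; the ONE open stub is the bet `stub_flowEF` (C⁺).

Stubs (all independent given the objects):
* `stub_counter` — THE SOURCE (theorem-grade, size M): the ternary two-polarity counter: every diagonal cut
  `(D, D)` is the strict unique minimiser of `Y4 − μ·X2` for an integer slope `|μ| ≤ 3^(K+1)` (witness
  `μ = 4·sdot D + 1`; key identity `Δ = n(n−1) + [2·qdis − (sdot α − sdot β)²]`, `n = sdot α + sdot β − 2 sdot D`,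
  and `(∑_{i∈T} 3^i)² + ∑_{i∈T} 3^i ≤ 2 ∑_{i∈T} 9^i`).
* `stub_flowEF` — THE BET C⁺ (hardest, size X, the lead's): a quasi-polynomial-size weighted pattern whose
  parametric min-cost perfect-matching value equals the counter's parametric value up to an affine function on
  the slope window `|μ| ≤ 3^(K+2)`.
* `stub_transfer` — (size M) counter + C⁺ ⇒ `2^K` lower vertices of the pattern's value set at size
  `≤ 2^((log₂ K + k)^k)` (margin argument: near each supporting slope the value function is affine with slope
  `−X2(D,D) + d`, so every active point of the pattern has abscissa `X2(D,D) − d`; distinct `D` have distinct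
  `X2(D,D) = 2·sdot D`).
* `stub_growth` — (size S/M, arithmetic) quasi-polynomial size with `2^K` lower vertices ⇒ for every `c` and all
  large `n` a pattern of size `≤ n` with more than `2^((log₂ n + c)^c)` lower vertices (`K := (log₂ n + c)^c + 1`).
* `stub_bridge` — (size M) lower vertices of a pattern's value set are shadow vertices of `DS_n` after padding
  (`stub_facePad`, landed) and an off-pattern penalty (pattern of `stub_faceVertices` / `faceShadow_pencil`, landed).
* `ShadowBirkhoff_closed` — the crux BY NAME: `stub_bridge (stub_growth (stub_transfer stub_counter stub_flowEF))`.

Disproof used: `Cruxes/ShadowBirkhoff/Disproof.lean` has no `_false_without_` theorem (hypothesis-free crux).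
Honoured: §3–§4 values lemmas (the counter's functionals take `2^K` / `≈ 9^K` values; quasi-poly transfer gives
super-polylog bit length as required); §6 Minkowski additivity (the counter is bilinear, not a product); §7
Gusfield cap and the card's pathwidth cap (C⁺ cannot be met through path faces); §8 row-set entropy (C⁺ demands
`2^K` interface patterns of the auxiliary pattern).  Dead lines honoured: all six are flow-side gadget families;
C⁺ is stated polyhedrally (non-semantic EF), gadget transcriptions of the counter are recorded dead in the card.
-/

set_option linter.dupNamespace false

noncomputable section

open scoped BigOperators

namespace Summit.ValiantsHypothesis.ValiantsHypothesis.Theorems.DivisionGapShadowBirkhoff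

/-! ## Stubs -/

/-- **STUB 2 · `stub_flowEF`** — C⁺, THE BET (registered signature; hardest stub, the lead's): a
quasi-polynomial flow-extended formulation of the counter — for some `k` and every `K` a weighted pattern
`G ⊆ [N]²`, `N ≤ 2^((log₂ K + k)^k)`, supporting a permutation, with
`patternVal G wb wa μ = counterVal K μ + c + d·μ` for all `|μ| ≤ 3^(K+2)`. -/
theorem stub_flowEF :
    ∃ k : ℕ, ∀ K : ℕ, ∃ N : ℕ, N ≤ 2 ^ ((Nat.log 2 K + k) ^ k) ∧
      ∃ (G : Finset (Fin N × Fin N)) (wb wa : Fin N → Fin N → ℝ) (c d : ℝ),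
        (∃ ρ : Equiv.Perm (Fin N), ∀ u, (u, ρ u) ∈ G) ∧
        ∀ μ : ℝ, |μ| ≤ (3 : ℝ) ^ (K + 2) → patternVal G wb wa μ = counterVal K μ + c + d * μ := by
  sorry

/-! ## Composition -/

/-- **`ShadowBirkhoff_closed`** — the crux BY NAME from the five stubs. -/
theorem ShadowBirkhoff_closed :
    Summit.ValiantsHypothesis.ValiantsHypothesis.Theses.DivisionGap.ShadowBirkhoff :=
  stub_bridge (stub_growth (stub_transfer stub_counter stub_flowEF))

end Summit.ValiantsHypothesis.ValiantsHypothesis.Theorems.DivisionGapShadowBirkhoff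

end
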